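import Literature.Geometry.Riemannian.TwistorBundleMaps
import Literature.Geometry.Riemannian.TwistorChartTransport
import HarnessLib

/-!
# The twistor space of an oriented Riemannian 4-manifold: the package (`exists_twistorSpace_holds`)

Discharge of the named fact `exists_twistorSpace` of `TwistorPackage.lean`
(Atiyah–Hitchin–Singer 1978, §4; Besse 1987, 13.44 and 13.63; Fine–Panov 2009, Prop. 2.1;
Fine–Krasnov–Panov 2014, §4.1, Lemma 12 and Remark 13): for every smooth oriented Riemannian
4-manifold `(M, o, g)` the sphere bundle `Z = S(Λ⁺M)` with its projection, fibrewise antipodal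
map and coupling 2-form is a `TwistorPackage M` satisfying `IsTwistorSpaceOf g o`.

Assembly of the construction of the sibling files:
* `TwistorFrames` (F), `TwistorBundle` (B), `TwistorBundleMaps` (B′) — the total space
  `twistorTotal g hg o` (a `FiberBundleCore` over `M` with fibre `S²` indexed by the positive
  orthonormal frames, `ℝ⁶`-charts, `IsManifold (𝓡 6) ∞`), smoothness of the trivialisations,
  of the projection (a surjective submersion with fibres `S²`) and of the antipodal map `τ`;
* `TwistorCouplingModel` (V-c), `TwistorChartConnection` (V-b), `TwistorChartGauge` (V-d),
  `TwistorChartTransport` (T) — the minimal-coupling form `couplingForm g ∇ e` of a frame on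
  `M × S²` is, over a chart, the pull-back of the closed smooth model form; two frames give
  gauge-related model forms.

Here: the coupling form `twistorOmega` of `Z` is DEFINED at `z` as the pull-back of
`couplingForm g ∇ e_F` along the trivialisation of the frame `F` chosen at `π z`; it does not
depend on the frame (`pullback_triv_eq_of_mem`, gauge covariance), hence equals near every point
the pull-back of a smooth closed model form along a smooth chart map (`twistorOmega_eq_chi`),
which gives smoothness, closedness (`d` commutes with pull-backs, `mextDeriv_pullback_apply`,
and the model form is closed on tangent triples), `τ^*ω = -ω` (the antipodal symmetry of the model
form) and vertical non-degeneracy (`(2π)⁻¹ ×` the area form of the fibre). The local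
diffeomorphisms `π⁻¹(U) ≅ U × S²` of `IsTwistorSpaceOf` are the trivialisations, and the
tautological complex structure is `J z = J_ζ(e_F(π z))` read in the frame at `π z`
(frame-independent by `TwistorFrame.frameComplexStructure_eq`).

## References

* M. F. Atiyah, N. J. Hitchin, I. M. Singer, *Self-duality in four-dimensional Riemannian
  geometry*, Proc. R. Soc. A 362 (1978), §4. [AtiyahHitchinSinger1978]
* A. L. Besse, *Einstein manifolds* (1987), 13.44, 13.63. [Besse1987]
* J. Fine, D. Panov, J. Differential Geom. 82 (2009), §2.1, Prop. 2.1. [FinePanov2009]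
* J. Fine, K. Krasnov, D. Panov, New York J. Math. 20 (2014), §4.1, Lemma 12, Remark 13.
  [FineKrasnovPanov2014]
-/

noncomputable section

open Bundle Set Function Filter TopologicalSpace
open scoped Manifold ContDiff Topology Matrix BigOperators

namespace Literature.Geometry.Riemannian

open Literature.Geometry.Lorentzian (PseudoRiemannianMetric)
open Literature.Geometry.Lorentzian.PseudoRiemannianMetric
open Literature.Geometry.Kaehler
open Literature.Topology.FourManifolds (SmoothOrientation)
open TwistorChart

/-- Local notation: the model space `ℝ⁴`. -/
local notation "E4" => EuclideanSpace ℝ (Fin 4)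
/-- Local notation: `ℝ³` as a Euclidean space. -/
local notation "E3" => EuclideanSpace ℝ (Fin 3)
/-- Local notation: `ℝ²`, the model of the fibre sphere. -/
local notation "E2" => EuclideanSpace ℝ (Fin 2)
/-- Local notation: `ℝ³` as plain vectors. -/
local notation "R3" => Fin 3 → ℝ
/-- Local notation: the unit 2-sphere in `ℝ³`. -/
local notation "𝕊²" => (Metric.sphere (0 : EuclideanSpace ℝ (Fin 3)) 1)

universe u

variable {M : Type u} [TopologicalSpace M] [ChartedSpace (EuclideanSpace ℝ (Fin 4)) M]
  [IsManifold (𝓡 4) ∞ M]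
  (g : PseudoRiemannianMetric (𝓡 4) ∞ E4 (TangentSpace (𝓡 4) : M → Type _))
  (hg : g.IsRiemannian) (o : SmoothOrientation (𝓡 4) M)

/-! ### Charts adapted to a pair of frames -/

variable {g o} in
/-- The preferred chart of `M` at `x` restricted to the common domain of two twistor frames.
[folklore] -/
def frameChart (F F' : TwistorFrame g o) (x : M) : OpenPartialHomeomorph M E4 :=
  (chartAt E4 x).restr ((F.U : Set M) ∩ F'.U)

variable {g o} in
/-- The adapted chart belongs to the maximal atlas (restriction of a chart to an open set).
[folklore] -/
theorem frameChart_mem_maximalAtlas (F F' : TwistorFrame g o) (x : M) :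
    frameChart F F' x ∈ IsManifold.maximalAtlas (𝓡 4) ∞ M :=
  restr_mem_maximalAtlas (contDiffGroupoid ∞ (𝓡 4)) (IsManifold.chart_mem_maximalAtlas x)
    (F.U.isOpen.inter F'.U.isOpen)

variable {g o} in
/-- The source of the adapted chart. [folklore] -/
theorem frameChart_source (F F' : TwistorFrame g o) (x : M) :
    (frameChart F F' x).source = (chartAt E4 x).source ∩ ((F.U : Set M) ∩ F'.U) := by
  rw [frameChart, OpenPartialHomeomorph.restr_source, (F.U.isOpen.inter F'.U.isOpen).interior_eq]

variable {g o} in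
/-- The source of the adapted chart lies in the domain of the first frame. [folklore] -/
theorem frameChart_source_subset_left (F F' : TwistorFrame g o) (x : M) :
    (frameChart F F' x).source ⊆ F.U := fun y hy ↦ by
  rw [frameChart_source] at hy
  exact hy.2.1

variable {g o} in
/-- The source of the adapted chart lies in the domain of the second frame. [folklore] -/
theorem frameChart_source_subset_right (F F' : TwistorFrame g o) (x : M) :
    (frameChart F F' x).source ⊆ F'.U := fun y hy ↦ by
  rw [frameChart_source] at hy
  exact hy.2.2

variable {g o} in
/-- The centre lies in the source of the adapted chart. [folklore] -/
theorem mem_frameChart_source {F F' : TwistorFrame g o} {x : M} (hx : x ∈ F.U) (hx' : x ∈ F'.U) :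
    x ∈ (frameChart F F' x).source := by
  rw [frameChart_source]
  exact ⟨mem_chart_source E4 x, hx, hx'⟩

/-! ### The trivialisations and their chart maps -/

/-- The local trivialisation of the twistor bundle attached to the frame `F`, as a map
`Z → M × S²`. [cite: AtiyahHitchinSinger1978, §4] -/
abbrev triv (F : TwistorFrame g o) : twistorTotal g hg o → M × 𝕊² :=
  (twistorCore g hg o).localTriv F

/-- The first component of a trivialisation is the projection. [folklore] -/
theorem triv_fst (F : TwistorFrame g o) (z : twistorTotal g hg o) : (triv g hg o F z).1 = z.proj :=
  rfl

/-- The second component of a trivialisation is the coordinate change from the frame at `π z`.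
[folklore] -/
theorem triv_snd (F : TwistorFrame g o) (z : twistorTotal g hg o) :
    (triv g hg o F z).2 = twistorCoordChange (twistorFrameAt g hg o z.proj) F z.proj z.2 :=
  rfl

/-- The fibre coordinate of a point of the total space, a point of `S²` (the coordinate in the
trivialisation of the frame chosen at its base point). [folklore] -/
abbrev fiberCoord (z : twistorTotal g hg o) : 𝕊² := z.2

/-- A trivialisation is differentiable over its base set. [folklore] -/
theorem mdifferentiableAt_triv (F : TwistorFrame g o) {z : twistorTotal g hg o} (hz : z.proj ∈ F.U) :
    MDifferentiableAt (𝓡 6) ((𝓡 4).prod (𝓡 2)) (triv g hg o F) z :=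
  (contMDiffAt_localTriv g hg o F (((twistorCore g hg o).mem_localTriv_source F z).2 hz)).mdifferentiableAt
    (by simp)

/-- A trivialisation is smooth over its base set. [folklore] -/
theorem contMDiffAt_triv (F : TwistorFrame g o) {z : twistorTotal g hg o} (hz : z.proj ∈ F.U) :
    ContMDiffAt (𝓡 6) ((𝓡 4).prod (𝓡 2)) ∞ (triv g hg o F) z :=
  contMDiffAt_localTriv g hg o F (((twistorCore g hg o).mem_localTriv_source F z).2 hz)

/-- Points near `z` project into any open set containing `π z`. [folklore] -/
theorem eventually_proj_mem {V : Set M} (hV : IsOpen V) {z : twistorTotal g hg o} (hz : z.proj ∈ V) :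
    ∀ᶠ z' in 𝓝 z, z'.proj ∈ V :=
  (contMDiff_twistorProj g hg o).continuous.continuousAt.preimage_mem_nhds (hV.mem_nhds hz)

/-- **The differential of the projection is the first component of the differential of a
trivialisation**: `dπ_z = pr₁ ∘ d(triv F)_z` over the base set of `F`. [folklore] -/
theorem mfderiv_twistorProj_eq (F : TwistorFrame g o) {z : twistorTotal g hg o} (hz : z.proj ∈ F.U) :
    mfderiv (𝓡 6) (𝓡 4) (twistorProj g hg o) z =
      (ContinuousLinearMap.fst ℝ E4 E2).comp (mfderiv (𝓡 6) ((𝓡 4).prod (𝓡 2)) (triv g hg o F) z) := by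
  have h := ((hasMFDerivAt_fst (I := 𝓡 4) (I' := 𝓡 2) (triv g hg o F z)).comp z
    (mdifferentiableAt_triv g hg o F hz).hasMFDerivAt).mfderiv
  exact h

/-- **The chart map of a frame**: the trivialisation of `F` followed by the chart map
`(x, ζ) ↦ (ψ x, ζ)` of `M × S²` — a map `Z → ℝ⁴ × ℝ³`. [folklore] -/
def chi (ψ : OpenPartialHomeomorph M E4) (F : TwistorFrame g o) : twistorTotal g hg o → E4 × E3 :=
  fun z ↦ chartProd ψ (triv g hg o F z)

/-- Unfolding `chi`. [folklore] -/
theorem chi_apply (ψ : OpenPartialHomeomorph M E4) (F : TwistorFrame g o) (z : twistorTotal g hg o) :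
    chi g hg o ψ F z = (ψ z.proj, ((triv g hg o F z).2 : E3)) :=
  rfl

/-- `chi = chartProd ψ ∘ triv F`. [folklore] -/
theorem chi_eq_comp (ψ : OpenPartialHomeomorph M E4) (F : TwistorFrame g o) :
    chi g hg o ψ F = chartProd ψ ∘ triv g hg o F :=
  rfl

variable {ψ : OpenPartialHomeomorph M E4}

/-- The chart map of a frame is smooth over `ψ.source ∩ U_F`. [folklore] -/
theorem contMDiffAt_chi (hψ : ψ ∈ IsManifold.maximalAtlas (𝓡 4) ∞ M) (F : TwistorFrame g o)
    {z : twistorTotal g hg o} (hzF : z.proj ∈ F.U) (hzψ : z.proj ∈ ψ.source) :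
    ContMDiffAt (𝓡 6) 𝓘(ℝ, E4 × E3) ∞ (chi g hg o ψ F) z :=
  (contMDiffAt_chartProd hψ (q := triv g hg o F z) hzψ).comp z (contMDiffAt_triv g hg o F hzF)

/-- The chart map of a frame is smooth near the points over `ψ.source ⊆ U_F`. [folklore] -/
theorem eventually_contMDiffAt_chi (hψ : ψ ∈ IsManifold.maximalAtlas (𝓡 4) ∞ M)
    (F : TwistorFrame g o) (hF : ψ.source ⊆ F.U) {z : twistorTotal g hg o}
    (hz : z.proj ∈ ψ.source) :
    ∀ᶠ z' in 𝓝 z, ContMDiffAt (𝓡 6) 𝓘(ℝ, E4 × E3) ∞ (chi g hg o ψ F) z' :=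
  (eventually_proj_mem g hg o ψ.open_source hz).mono fun _ hz' ↦
    contMDiffAt_chi g hg o hψ F (hF hz') hz'

/-- The chart map of a frame is differentiable over `ψ.source ⊆ U_F`. [folklore] -/
theorem mdifferentiableAt_chi (hψ : ψ ∈ IsManifold.maximalAtlas (𝓡 4) ∞ M) (F : TwistorFrame g o)
    (hF : ψ.source ⊆ F.U) {z : twistorTotal g hg o} (hz : z.proj ∈ ψ.source) :
    MDifferentiableAt (𝓡 6) 𝓘(ℝ, E4 × E3) (chi g hg o ψ F) z :=
  (contMDiffAt_chi g hg o hψ F (hF hz) hz).mdifferentiableAt (by simp)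

/-- **The differential of the chart map of a frame**:
`dχ_z(v) = (dψ (d(triv F) v)₁, dι (d(triv F) v)₂)`. [folklore] -/
theorem mfderiv_chi_apply (hψ : ψ ∈ IsManifold.maximalAtlas (𝓡 4) ∞ M) (F : TwistorFrame g o)
    (hF : ψ.source ⊆ F.U) {z : twistorTotal g hg o} (hz : z.proj ∈ ψ.source)
    (v : TangentSpace (𝓡 6) z) :
    mfderiv (𝓡 6) 𝓘(ℝ, E4 × E3) (chi g hg o ψ F) z v =
      (mfderiv (𝓡 4) 𝓘(ℝ, E4) ψ z.proj
          (mfderiv (𝓡 6) ((𝓡 4).prod (𝓡 2)) (triv g hg o F) z v).1,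
        (mfderiv (𝓡 2) 𝓘(ℝ, E3) (Subtype.val : 𝕊² → E3) (triv g hg o F z).2 : E2 →L[ℝ] E3)
          (mfderiv (𝓡 6) ((𝓡 4).prod (𝓡 2)) (triv g hg o F) z v).2) := by
  rw [chi_eq_comp, mfderiv_comp z ((contMDiffAt_chartProd hψ (q := triv g hg o F z)
    hz).mdifferentiableAt (by simp)) (mdifferentiableAt_triv g hg o F (hF hz))]
  exact mfderiv_chartProd_apply' hψ hz _

/-! ### The coupling form read through a trivialisation -/

variable [g.HasLeviCivita]

/-- **The pull-back of the coupling form of `F` along its trivialisation is the pull-back of the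
model form along the chart map** (over `ψ.source ⊆ U_F`): `(triv F)^* Ω_F = χ^* Ω̂_F` at `z`
(`couplingForm_eq_pullback` and the chain rule). [cite: FinePanov2009, Prop. 2.1] -/
theorem pullback_triv_eq_pullback_chi (hψ : ψ ∈ IsManifold.maximalAtlas (𝓡 4) ∞ M)
    (F : TwistorFrame g o) (hF : ψ.source ⊆ F.U) {z : twistorTotal g hg o}
    (hz : z.proj ∈ ψ.source) :
    (couplingForm g g.leviCivita F.frame).pullback (𝓡 6) (triv g hg o F) z =
      (modelFormOf hψ F).pullback (𝓡 6) (chi g hg o ψ F) z := by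
  have hd : ∀ w : TangentSpace (𝓡 6) z, mfderiv (𝓡 6) 𝓘(ℝ, E4 × E3) (chi g hg o ψ F) z w =
      mfderiv ((𝓡 4).prod (𝓡 2)) 𝓘(ℝ, E4 × E3) (chartProd ψ) (triv g hg o F z)
        (mfderiv (𝓡 6) ((𝓡 4).prod (𝓡 2)) (triv g hg o F) z w) := fun w ↦ by
    rw [chi_eq_comp, mfderiv_comp z ((contMDiffAt_chartProd hψ (q := triv g hg o F z)
      hz).mdifferentiableAt (by simp)) (mdifferentiableAt_triv g hg o F (hF hz))]
    rfl
  ext v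
  rw [MForm.pullback_apply, MForm.pullback_apply,
    couplingForm_eq_pullback' hψ F hF (q := triv g hg o F z) hz, MForm.pullback_apply]
  simp only [hd]
  rfl

/-- **Gauge covariance: the pulled-back coupling form does not depend on the frame.** For two
twistor frames `F₁, F₂` and `z` over `U₁ ∩ U₂`,
`(triv F₁)^* Ω_{F₁} (z) = (triv F₂)^* Ω_{F₂} (z)`. In an adapted chart both sides are pull-backs
of model forms along chart maps `χ₁, χ₂` with `χ₂ = transMap ∘ χ₁` near `z` (the cocycle of the
coordinate changes), and `Ω̂_{F₁} = transMap^* Ω̂_{F₂}` (`modelFormOf_transMap`, the gauge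
covariance of the minimal-coupling form, Fine–Panov 2009, Prop. 2.1).
[cite: FinePanov2009, Prop. 2.1] -/
theorem pullback_triv_eq_of_mem (F₁ F₂ : TwistorFrame g o) {z : twistorTotal g hg o}
    (h₁ : z.proj ∈ F₁.U) (h₂ : z.proj ∈ F₂.U) :
    (couplingForm g g.leviCivita F₁.frame).pullback (𝓡 6) (triv g hg o F₁) z =
      (couplingForm g g.leviCivita F₂.frame).pullback (𝓡 6) (triv g hg o F₂) z := by
  set ψ := frameChart F₁ F₂ z.proj with hψdef
  have hψ : ψ ∈ IsManifold.maximalAtlas (𝓡 4) ∞ M := frameChart_mem_maximalAtlas F₁ F₂ z.proj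
  have hs₁ : ψ.source ⊆ F₁.U := frameChart_source_subset_left F₁ F₂ z.proj
  have hs₂ : ψ.source ⊆ F₂.U := frameChart_source_subset_right F₁ F₂ z.proj
  have hz : z.proj ∈ ψ.source := mem_frameChart_source h₁ h₂
  rw [pullback_triv_eq_pullback_chi g hg o hψ F₁ hs₁ hz,
    pullback_triv_eq_pullback_chi g hg o hψ F₂ hs₂ hz]
  -- `χ₂ = transMap ∘ χ₁` near `z`
  have hev : chi g hg o ψ F₂ =ᶠ[𝓝 z] (transMap hψ F₁ F₂ ∘ chi g hg o ψ F₁) := by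
    filter_upwards [eventually_proj_mem g hg o ψ.open_source hz] with z' hz'
    rw [Function.comp_apply, chi_apply, chi_apply, transMap_apply_of_mem hψ F₁ F₂ hz']
    refine Prod.ext rfl ?_
    change ((triv g hg o F₂ z').2 : E3) = WithLp.toLp 2 (frameTransition g z'.proj (F₂.fr z'.proj)
      (F₁.fr z'.proj) (WithLp.ofLp ((triv g hg o F₁ z').2 : E3)))
    rw [← coe_twistorCoordChange (hs₁ hz') (hs₂ hz'), triv_snd, triv_snd,
      twistorCoordChange_comp _ F₁ F₂ (mem_twistorFrameAt g hg o z'.proj) (hs₁ hz') (hs₂ hz')]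
  have hr : (chi g hg o ψ F₁ z).1 ∈ ψ.target := ψ.map_source hz
  have hT : MDifferentiableAt 𝓘(ℝ, E4 × E3) 𝓘(ℝ, E4 × E3) (transMap hψ F₁ F₂) (chi g hg o ψ F₁ z) :=
    mdifferentiableAt_iff_differentiableAt.2 (differentiableAt_transMap hψ F₁ F₂ hs₁ hs₂ hr)
  have hχ₁ := mdifferentiableAt_chi g hg o hψ F₁ hs₁ hz
  ext v
  rw [MForm.pullback_apply, MForm.pullback_apply]
  have hcongr : ∀ {P P' : E4 × E3} {W W' : Fin 2 → E4 × E3}, P = P' → W = W' →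
      modelFormOf hψ F₂ P W = modelFormOf hψ F₂ P' W' := by
    rintro _ _ _ _ rfl rfl; rfl
  have hP : chi g hg o ψ F₂ z = transMap hψ F₁ F₂ (chi g hg o ψ F₁ z) := hev.eq_of_nhds
  have hW : (fun i ↦ mfderiv (𝓡 6) 𝓘(ℝ, E4 × E3) (chi g hg o ψ F₂) z (v i)) =
      fun i ↦ fderiv ℝ (transMap hψ F₁ F₂) (chi g hg o ψ F₁ z)
        (mfderiv (𝓡 6) 𝓘(ℝ, E4 × E3) (chi g hg o ψ F₁) z (v i)) := by
    funext i
    rw [hev.mfderiv_eq, mfderiv_comp z hT hχ₁, mfderiv_eq_fderiv]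
    rfl
  symm
  exact (hcongr hP hW).trans (modelFormOf_transMap hψ F₁ F₂ hs₁ hs₂ hr _)

/-! ### The coupling form of the twistor space -/

/-- **The coupling 2-form `ω` of the twistor space** `Z = S(Λ⁺M)`: at `z`, the pull-back of the
minimal-coupling form `couplingForm g ∇ e_F` (Fine–Panov 2009, Prop. 2.1; FKP 2014, §4.1:
`ω = (i/2π) F_{∇^V}`) along the trivialisation of the positive orthonormal frame `F` chosen at
`π z`; independent of the frame (`twistorOmega_eq`). [cite: FineKrasnovPanov2014, §4.1] -/
def twistorOmega : MForm (𝓡 6) (twistorTotal g hg o) ℝ 2 := fun z ↦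
  (couplingForm g g.leviCivita (twistorFrameAt g hg o z.proj).frame).pullback (𝓡 6)
    (triv g hg o (twistorFrameAt g hg o z.proj)) z

/-- **`ω` in any trivialisation**: over `U_F`, `ω = (triv F)^* Ω_F` pointwise.
[cite: FineKrasnovPanov2014, §4.1] -/
theorem twistorOmega_eq (F : TwistorFrame g o) {z : twistorTotal g hg o} (hz : z.proj ∈ F.U) :
    twistorOmega g hg o z =
      (couplingForm g g.leviCivita F.frame).pullback (𝓡 6) (triv g hg o F) z :=
  pullback_triv_eq_of_mem g hg o _ F (mem_twistorFrameAt g hg o z.proj) hz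

/-- **`ω` in a chart**: over `ψ.source ⊆ U_F`, `ω = χ^* Ω̂_F` pointwise, the pull-back of the
model coupling form along the chart map of the frame. [cite: FineKrasnovPanov2014, §4.1] -/
theorem twistorOmega_eq_chi (hψ : ψ ∈ IsManifold.maximalAtlas (𝓡 4) ∞ M) (F : TwistorFrame g o)
    (hF : ψ.source ⊆ F.U) {z : twistorTotal g hg o} (hz : z.proj ∈ ψ.source) :
    twistorOmega g hg o z = (modelFormOf hψ F).pullback (𝓡 6) (chi g hg o ψ F) z :=
  (twistorOmega_eq g hg o F (hF hz)).trans (pullback_triv_eq_pullback_chi g hg o hψ F hF hz)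

/-- `ω = χ^* Ω̂_F` near every point over `ψ.source ⊆ U_F`. [cite: FineKrasnovPanov2014, §4.1] -/
theorem twistorOmega_eventuallyEq_chi (hψ : ψ ∈ IsManifold.maximalAtlas (𝓡 4) ∞ M)
    (F : TwistorFrame g o) (hF : ψ.source ⊆ F.U) {z : twistorTotal g hg o}
    (hz : z.proj ∈ ψ.source) :
    ∀ᶠ z' in 𝓝 z, twistorOmega g hg o z' = (modelFormOf hψ F).pullback (𝓡 6) (chi g hg o ψ F) z' :=
  (eventually_proj_mem g hg o ψ.open_source hz).mono fun _ hz' ↦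
    twistorOmega_eq_chi g hg o hψ F hF hz'

omit [g.HasLeviCivita] in
/-- The pull-back of the model form along the chart map is smooth over `ψ.source ⊆ U_F`
(pull-back of a smooth form along a smooth map, Warner 2.22). [cite: WarnerGTM94, 2.22] -/
theorem smoothAt_pullback_chi (hψ : ψ ∈ IsManifold.maximalAtlas (𝓡 4) ∞ M) (F : TwistorFrame g o)
    (hF : ψ.source ⊆ F.U) {z : twistorTotal g hg o} (hz : z.proj ∈ ψ.source) :
    ((modelFormOf hψ F).pullback (𝓡 6) (chi g hg o ψ F)).SmoothAt z :=
  MForm.SmoothAt.pullback (eventually_contMDiffAt_chi g hg o hψ F hF hz)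
    (smoothAt_modelFormOf hψ F hF (r := chi g hg o ψ F z) (ψ.map_source hz))

/-- **`ω` is smooth.** [cite: FineKrasnovPanov2014, §4.1] -/
theorem isSmoothForm_twistorOmega : IsSmoothForm (twistorOmega g hg o) := fun z ↦ by
  have hzF : z.proj ∈ (twistorFrameAt g hg o z.proj).U := mem_twistorFrameAt g hg o z.proj
  have hψ := frameChart_mem_maximalAtlas (twistorFrameAt g hg o z.proj)
    (twistorFrameAt g hg o z.proj) z.proj
  have hF := frameChart_source_subset_left (twistorFrameAt g hg o z.proj)
    (twistorFrameAt g hg o z.proj) z.proj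
  have hz : z.proj ∈ (frameChart (twistorFrameAt g hg o z.proj) (twistorFrameAt g hg o z.proj)
    z.proj).source := mem_frameChart_source hzF hzF
  exact (smoothAt_pullback_chi g hg o hψ _ hF hz).congr_of_eventuallyEq
    ((twistorOmega_eventuallyEq_chi g hg o hψ _ hF hz).mono fun _ h ↦ h.symm)

/-- **`ω` is closed**: `dω = 0` at every point — `d` commutes with the pull-back along the smooth
chart map (Warner, Prop. 2.23) and the model coupling form is closed on tangent triples
(`mextDeriv_modelFormOf_apply_eq_zero`: the structure equation and the Bianchi identity).
[cite: FinePanov2009, Prop. 2.1] -/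
theorem mextDeriv_twistorOmega_apply (z : twistorTotal g hg o) : mextDeriv (twistorOmega g hg o) z = 0 := by
  set F := twistorFrameAt g hg o z.proj with hFdef
  have hzF : z.proj ∈ F.U := mem_twistorFrameAt g hg o z.proj
  have hψ := frameChart_mem_maximalAtlas F F z.proj
  have hF := frameChart_source_subset_left F F z.proj
  have hz : z.proj ∈ (frameChart F F z.proj).source := mem_frameChart_source hzF hzF
  rw [mextDeriv_congr_of_eventuallyEq (twistorOmega_eventuallyEq_chi g hg o hψ F hF hz),
    mextDeriv_pullback_apply (eventually_contMDiffAt_chi g hg o hψ F hF hz)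
      (smoothAt_modelFormOf hψ F hF (r := chi g hg o _ F z) ((frameChart F F z.proj).map_source hz))]
  ext v
  rw [MForm.pullback_apply]
  have h0 := mextDeriv_modelFormOf_apply_eq_zero hψ F hF (r := chi g hg o _ F z)
    ((frameChart F F z.proj).map_source hz) (dotProduct_self_sphere _)
    (fun i ↦ mfderiv (𝓡 6) 𝓘(ℝ, E4 × E3) (chi g hg o (frameChart F F z.proj) F) z (v i))
    (fun i ↦ by
      rw [mfderiv_chi_apply g hg o hψ F hF hz]
      exact dotProduct_mfderiv_coe_sphere _ _)
  exact h0

/-- **`ω` is closed.** [cite: FinePanov2009, Prop. 2.1] -/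
theorem isClosedForm_twistorOmega : IsClosedForm (twistorOmega g hg o) :=
  funext fun z ↦ mextDeriv_twistorOmega_apply g hg o z

/-- **`τ^* ω = -ω`**: in a trivialisation `τ` is `id × (antipodal map)`, the chart map satisfies
`χ ∘ τ = (id × (-id)) ∘ χ`, and the model coupling form is odd under `id × (-id)`
(`modelForm_antipode`). [cite: FineKrasnovPanov2014, §4.1] -/
theorem pullback_tau_twistorOmega :
    (twistorOmega g hg o).pullback (𝓡 6) (twistorTau g hg o) = -twistorOmega g hg o := by
  funext z
  set F := twistorFrameAt g hg o z.proj with hFdef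
  have hzF : z.proj ∈ F.U := mem_twistorFrameAt g hg o z.proj
  set ψ := frameChart F F z.proj with hψdef
  have hψ : ψ ∈ IsManifold.maximalAtlas (𝓡 4) ∞ M := frameChart_mem_maximalAtlas F F z.proj
  have hF : ψ.source ⊆ F.U := frameChart_source_subset_left F F z.proj
  have hz : z.proj ∈ ψ.source := mem_frameChart_source hzF hzF
  have hzτ : (twistorTau g hg o z).proj ∈ ψ.source := hz
  set A : (E4 × E3) →L[ℝ] (E4 × E3) :=
    (ContinuousLinearMap.fst ℝ E4 E3).prod (-ContinuousLinearMap.snd ℝ E4 E3) with hA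
  have hAapp : ∀ r : E4 × E3, A r = (r.1, -r.2) := fun r ↦ rfl
  have hcomp : chi g hg o ψ F ∘ twistorTau g hg o = ⇑A ∘ chi g hg o ψ F := by
    funext z'
    simp only [Function.comp_apply, chi, localTriv_twistorTau, chartProd_apply, hAapp,
      coe_neg_sphere]
  have hχ : MDifferentiableAt (𝓡 6) 𝓘(ℝ, E4 × E3) (chi g hg o ψ F) z :=
    mdifferentiableAt_chi g hg o hψ F hF hz
  have hχτ : MDifferentiableAt (𝓡 6) 𝓘(ℝ, E4 × E3) (chi g hg o ψ F) (twistorTau g hg o z) :=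
    mdifferentiableAt_chi g hg o hψ F hF hzτ
  have hτ : MDifferentiableAt (𝓡 6) (𝓡 6) (twistorTau g hg o) z :=
    (contMDiff_twistorTau g hg o z).mdifferentiableAt (by simp)
  have hd : ∀ w : TangentSpace (𝓡 6) z,
      mfderiv (𝓡 6) 𝓘(ℝ, E4 × E3) (chi g hg o ψ F) (twistorTau g hg o z)
          (mfderiv (𝓡 6) (𝓡 6) (twistorTau g hg o) z w) =
        A (mfderiv (𝓡 6) 𝓘(ℝ, E4 × E3) (chi g hg o ψ F) z w) := fun w ↦ by
    have h1 := mfderiv_comp z hχτ hτ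
    have h2 : mfderiv (𝓡 6) 𝓘(ℝ, E4 × E3) (⇑A ∘ chi g hg o ψ F) z =
        A.comp (mfderiv (𝓡 6) 𝓘(ℝ, E4 × E3) (chi g hg o ψ F) z) := by
      rw [mfderiv_comp z A.mdifferentiableAt hχ, ContinuousLinearMap.mfderiv_eq]
      rfl
    rw [hcomp] at h1
    exact congrArg (fun f : TangentSpace (𝓡 6) z →L[ℝ] (E4 × E3) ↦ f w) (h1.symm.trans h2)
  ext v
  rw [MForm.pullback_apply, Pi.neg_apply, ContinuousAlternatingMap.neg_apply,
    twistorOmega_eq_chi g hg o hψ F hF hzτ, twistorOmega_eq_chi g hg o hψ F hF hz,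
    MForm.pullback_apply, MForm.pullback_apply]
  have hcongr : ∀ {P P' : E4 × E3} {W W' : Fin 2 → E4 × E3}, P = P' → W = W' →
      modelFormOf hψ F P W = modelFormOf hψ F P' W' := by
    rintro _ _ _ _ rfl rfl; rfl
  have hP : chi g hg o ψ F (twistorTau g hg o z) =
      ((chi g hg o ψ F z).1, -(chi g hg o ψ F z).2) := congrFun hcomp z
  have hW : (fun i ↦ mfderiv (𝓡 6) 𝓘(ℝ, E4 × E3) (chi g hg o ψ F) (twistorTau g hg o z)
      (mfderiv (𝓡 6) (𝓡 6) (twistorTau g hg o) z (v i))) =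
      fun i ↦ (((mfderiv (𝓡 6) 𝓘(ℝ, E4 × E3) (chi g hg o ψ F) z (v i)).1,
        -(mfderiv (𝓡 6) 𝓘(ℝ, E4 × E3) (chi g hg o ψ F) z (v i)).2) : E4 × E3) :=
    funext fun i ↦ hd (v i)
  exact (hcongr hP hW).trans (modelForm_antipode _ (chi g hg o ψ F z).1 (chi g hg o ψ F z).2 _)

/-! ### Vertical non-degeneracy -/

omit [g.HasLeviCivita] in
/-- The differential of a trivialisation is injective over its base set (the trivialisation has a
smooth left inverse). [folklore] -/
theorem mfderiv_triv_injective (F : TwistorFrame g o) {z : twistorTotal g hg o} (hz : z.proj ∈ F.U) :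
    Function.Injective (mfderiv (𝓡 6) ((𝓡 4).prod (𝓡 2)) (triv g hg o F) z) := by
  set T := (twistorCore g hg o).localTriv F with hT
  have hzs : z ∈ T.source := ((twistorCore g hg o).mem_localTriv_source F z).2 hz
  have hTz : T z ∈ T.target := T.map_source hzs
  have hd : MDifferentiableAt (𝓡 6) ((𝓡 4).prod (𝓡 2)) T z := mdifferentiableAt_triv g hg o F hz
  have hd' : MDifferentiableAt ((𝓡 4).prod (𝓡 2)) (𝓡 6) T.toOpenPartialHomeomorph.symm (T z) :=
    (contMDiffAt_localTriv_symm g hg o F hTz).mdifferentiableAt (by simp)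
  have heq : (T.toOpenPartialHomeomorph.symm ∘ T) =ᶠ[𝓝 z] id := by
    filter_upwards [T.open_source.mem_nhds hzs] with z' hz'
    exact T.symm_apply_apply hz'
  have hid : (mfderiv ((𝓡 4).prod (𝓡 2)) (𝓡 6) T.toOpenPartialHomeomorph.symm (T z)).comp
      (mfderiv (𝓡 6) ((𝓡 4).prod (𝓡 2)) T z) = ContinuousLinearMap.id ℝ _ := by
    rw [← mfderiv_comp z hd' hd, heq.mfderiv_eq, mfderiv_id]
  intro v w hvw
  have h := congrArg (mfderiv ((𝓡 4).prod (𝓡 2)) (𝓡 6) T.toOpenPartialHomeomorph.symm (T z)) hvw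
  rw [← ContinuousLinearMap.comp_apply, ← ContinuousLinearMap.comp_apply, hid] at h
  exact h

/-- `⟨ζ, a × (ζ × a)⟩ = |ζ|²|a|² - ⟨ζ, a⟩²`. [folklore] -/
theorem dot_cross_cross_self (ζ a : R3) :
    ζ ⬝ᵥ crossProduct a (crossProduct ζ a) = (ζ ⬝ᵥ ζ) * (a ⬝ᵥ a) - (ζ ⬝ᵥ a) * (ζ ⬝ᵥ a) := by
  simp_rw [cross_apply, Matrix.vec3_dotProduct]
  dsimp only [Matrix.cons_val]
  ring

/-- **`ω` is non-degenerate on the vertical spaces**: for a non-zero vertical vector `v` at `z`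
there is a vertical `w` with `ω(v, w) ≠ 0`. In a chart `ω = χ^* Ω̂`, vertical vectors go to
`(0, a)`, `(0, b)` with `a, b ⊥ ζ`, on which `Ω̂ = (2π)⁻¹⟨ζ, a × b⟩` (`modelForm_vertical`, the
area form of the fibre); take `b = ζ × a`, so that `⟨ζ, a × b⟩ = |a|² ≠ 0`.
[cite: FinePanov2009, Prop. 2.1] -/
theorem twistorOmega_vertical_nondegenerate (z : twistorTotal g hg o) (v : TangentSpace (𝓡 6) z)
    (hv : mfderiv (𝓡 6) (𝓡 4) (twistorProj g hg o) z v = 0) (hv0 : v ≠ 0) :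
    ∃ w : TangentSpace (𝓡 6) z, mfderiv (𝓡 6) (𝓡 4) (twistorProj g hg o) z w = 0 ∧
      twistorOmega g hg o z ![v, w] ≠ 0 := by
  set F := twistorFrameAt g hg o z.proj with hFdef
  have hzF : z.proj ∈ F.U := mem_twistorFrameAt g hg o z.proj
  have hzs : z ∈ ((twistorCore g hg o).localTriv F).source :=
    ((twistorCore g hg o).mem_localTriv_source F z).2 hzF
  set ψ := frameChart F F z.proj with hψdef
  have hψ : ψ ∈ IsManifold.maximalAtlas (𝓡 4) ∞ M := frameChart_mem_maximalAtlas F F z.proj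
  have hF : ψ.source ⊆ F.U := frameChart_source_subset_left F F z.proj
  have hz : z.proj ∈ ψ.source := mem_frameChart_source hzF hzF
  have hproj : ∀ w : TangentSpace (𝓡 6) z, mfderiv (𝓡 6) (𝓡 4) (twistorProj g hg o) z w =
      (mfderiv (𝓡 6) ((𝓡 4).prod (𝓡 2)) (triv g hg o F) z w).1 := fun w ↦ by
    rw [mfderiv_twistorProj_eq g hg o F hzF]; rfl
  -- the vertical component of `v`
  have hv1 : (mfderiv (𝓡 6) ((𝓡 4).prod (𝓡 2)) (triv g hg o F) z v).1 = 0 := (hproj v).symm.trans hv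
  have hV : (mfderiv (𝓡 6) ((𝓡 4).prod (𝓡 2)) (triv g hg o F) z v).2 ≠ 0 := by
    intro h0
    apply hv0
    apply mfderiv_triv_injective g hg o F hzF
    rw [map_zero]
    exact Prod.ext hv1 h0
  have ha0 : WithLp.ofLp ((mfderiv (𝓡 2) 𝓘(ℝ, E3) (Subtype.val : 𝕊² → E3) (triv g hg o F z).2 :
      E2 →L[ℝ] E3) (mfderiv (𝓡 6) ((𝓡 4).prod (𝓡 2)) (triv g hg o F) z v).2) ≠ 0 := by
    intro h0
    apply hV
    apply mfderiv_coe_sphere_injective (n := 2) (triv g hg o F z).2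
    rw [WithLp.ofLp_eq_zero] at h0
    rw [h0]
    exact (map_zero _).symm
  -- the second vector: `b = ζ × a`
  set ζv : R3 := WithLp.ofLp ((triv g hg o F z).2 : E3) with hζv
  set a : R3 := WithLp.ofLp ((mfderiv (𝓡 2) 𝓘(ℝ, E3) (Subtype.val : 𝕊² → E3) (triv g hg o F z).2 :
      E2 →L[ℝ] E3) (mfderiv (𝓡 6) ((𝓡 4).prod (𝓡 2)) (triv g hg o F) z v).2) with ha
  have hb : WithLp.ofLp ((triv g hg o F z).2 : E3) ⬝ᵥ WithLp.ofLp (WithLp.toLp 2 (crossProduct ζv a)) = 0 := by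
    rw [WithLp.ofLp_toLp]
    exact dot_self_cross ζv a
  obtain ⟨W, hW⟩ := exists_mfderiv_coe_sphere_eq (triv g hg o F z).2 hb
  obtain ⟨w, hw⟩ := mfderiv_localTriv_surjective g hg o F hzs ((0 : E4), W)
  refine ⟨w, ?_, ?_⟩
  · rw [hproj, hw]
    rfl
  · rw [twistorOmega_eq_chi g hg o hψ F hF hz, MForm.pullback_apply]
    have hcongr : ∀ {W₁ W₂ : Fin 2 → E4 × E3}, W₁ = W₂ →
        modelFormOf hψ F (chi g hg o ψ F z) W₁ = modelFormOf hψ F (chi g hg o ψ F z) W₂ := by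
      rintro _ _ rfl; rfl
    have hvec : (fun i ↦ mfderiv (𝓡 6) 𝓘(ℝ, E4 × E3) (chi g hg o ψ F) z (![v, w] i)) =
        ![(((0 : E4), WithLp.toLp 2 a) : E4 × E3), ((0 : E4), WithLp.toLp 2 (crossProduct ζv a))] := by
      funext i
      fin_cases i
      · show mfderiv (𝓡 6) 𝓘(ℝ, E4 × E3) (chi g hg o ψ F) z v = ((0 : E4), WithLp.toLp 2 a)
        have h0 : mfderiv (𝓡 4) 𝓘(ℝ, E4) ψ z.proj
            (mfderiv (𝓡 6) ((𝓡 4).prod (𝓡 2)) (triv g hg o F) z v).1 = 0 := by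
          rw [hv1]; exact map_zero _
        rw [mfderiv_chi_apply g hg o hψ F hF hz, h0, ha, WithLp.toLp_ofLp]
        rfl
      · show mfderiv (𝓡 6) 𝓘(ℝ, E4 × E3) (chi g hg o ψ F) z w =
          ((0 : E4), WithLp.toLp 2 (crossProduct ζv a))
        have h0 : mfderiv (𝓡 4) 𝓘(ℝ, E4) ψ z.proj
            (mfderiv (𝓡 6) ((𝓡 4).prod (𝓡 2)) (triv g hg o F) z w).1 = 0 := by
          rw [hw]; exact map_zero _
        have h2 : (mfderiv (𝓡 6) ((𝓡 4).prod (𝓡 2)) (triv g hg o F) z w).2 = W := by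
          rw [hw]
        rw [mfderiv_chi_apply g hg o hψ F hF hz, h0, h2, hW]
        rfl
    refine ne_of_eq_of_ne (hcongr hvec) ?_
    refine ne_of_eq_of_ne (modelForm_vertical _ (ψ z.proj) ((triv g hg o F z).2 : E3)
      (WithLp.toLp 2 a) (WithLp.toLp 2 (crossProduct ζv a))) ?_
    rw [WithLp.ofLp_toLp, WithLp.ofLp_toLp, ← hζv, dot_cross_cross_self]
    have hζζ : ζv ⬝ᵥ ζv = 1 := dotProduct_self_sphere _
    have hζa : ζv ⬝ᵥ a = 0 := dotProduct_mfderiv_coe_sphere _ _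
    rw [hζζ, one_mul, hζa, mul_zero, sub_zero]
    exact mul_ne_zero (inv_ne_zero (mul_ne_zero two_ne_zero Real.pi_ne_zero))
      (fun h ↦ ha0 (dotProduct_self_eq_zero.1 h))

/-! ### The package -/

section Package

variable [T2Space M] [SecondCountableTopology M]

/-- **The twistor package of `(M, o, g)`**: total space `Z = S(Λ⁺M)` (`twistorTotal`), projection,
fibrewise antipodal map `τ` and coupling form `ω`, with all the axioms of `TwistorPackage`
(Atiyah–Hitchin–Singer 1978, §4; Besse 1987, 13.44, 13.63; Fine–Panov 2009, Prop. 2.1;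
FKP 2014, §4.1). [cite: FineKrasnovPanov2014, §4.1] -/
@[reducible] def twistorPackage : TwistorPackage.{u} M where
  Z := twistorTotal g hg o
  proj := twistorProj g hg o
  tau := twistorTau g hg o
  omega := twistorOmega g hg o
  contMDiff_proj := contMDiff_twistorProj g hg o
  proj_surjective := twistorProj_surjective g hg o
  mfderiv_proj_surjective := mfderiv_twistorProj_surjective g hg o
  nonempty_fiber_homeomorph := nonempty_fiber_homeomorph g hg o
  contMDiff_tau := contMDiff_twistorTau g hg o
  tau_tau := twistorTau_twistorTau g hg o
  tau_ne := twistorTau_ne g hg o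
  proj_tau := twistorProj_twistorTau g hg o
  isSmoothForm_omega := isSmoothForm_twistorOmega g hg o
  isClosedForm_omega := isClosedForm_twistorOmega g hg o
  pullback_tau_omega := pullback_tau_twistorOmega g hg o
  omega_vertical_nondegenerate := twistorOmega_vertical_nondegenerate g hg o

/-- The part of the twistor space over the domain of a frame, an open submanifold of `Z`
(definitionally `(twistorPackage g hg o).preim F.U`). [folklore] -/
def twistorPreim (F : TwistorFrame g o) : Opens (twistorTotal g hg o) :=
  ⟨twistorProj g hg o ⁻¹' (F.U : Set M), F.U.isOpen.preimage (contMDiff_twistorProj g hg o).continuous⟩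

/-- **The trivialisation of a frame as a diffeomorphism `π⁻¹(U_F) ≅ U_F × S²`.**
[cite: AtiyahHitchinSinger1978, §4] -/
def trivDiffeo (F : TwistorFrame g o) :
    (twistorPreim g hg o F) ≃ₘ⟮𝓡 6, (𝓡 4).prod (𝓡 2)⟯ (↥F.U × 𝕊²) where
  toFun z := (⟨(z.1 : twistorTotal g hg o).proj, z.2⟩, (triv g hg o F z.1).2)
  invFun p := ⟨((twistorCore g hg o).localTriv F).toOpenPartialHomeomorph.symm ((p.1 : M), p.2),
    p.1.2⟩
  left_inv z := Subtype.ext (((twistorCore g hg o).localTriv F).symm_apply_apply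
    (((twistorCore g hg o).mem_localTriv_source F _).2 z.2))
  right_inv p := by
    have hp : ((p.1 : M), p.2) ∈ ((twistorCore g hg o).localTriv F).target :=
      ((twistorCore g hg o).mem_localTriv_target F _).2 p.1.2
    have h := ((twistorCore g hg o).localTriv F).apply_symm_apply hp
    refine Prod.ext (Subtype.ext rfl) ?_
    show (triv g hg o F (((twistorCore g hg o).localTriv F).toOpenPartialHomeomorph.symm
      ((p.1 : M), p.2))).2 = p.2
    exact congrArg Prod.snd h
  contMDiff_toFun := by
    refine ContMDiff.prodMk (fun z ↦ ?_) (fun z ↦ ?_)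
    · refine (ContMDiffAt.subtypeVal_comp_iff F.U _ z).1 ?_
      exact ((contMDiff_twistorProj g hg o).comp contMDiff_subtype_val) z
    · exact ((contMDiffAt_triv g hg o F z.2).comp z (contMDiff_subtype_val z)).snd
  contMDiff_invFun := by
    intro p
    refine (ContMDiffAt.subtypeVal_comp_iff (twistorPreim g hg o F) _ p).1 ?_
    have hp : ((p.1 : M), p.2) ∈ ((twistorCore g hg o).localTriv F).target :=
      ((twistorCore g hg o).mem_localTriv_target F _).2 p.1.2
    have h1 : ContMDiffAt ((𝓡 4).prod (𝓡 2)) ((𝓡 4).prod (𝓡 2)) ∞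
        (fun q : ↥F.U × 𝕊² ↦ ((q.1 : M), q.2)) p :=
      (contMDiff_subtype_val.prodMap contMDiff_id) p
    show ContMDiffAt ((𝓡 4).prod (𝓡 2)) (𝓡 6) ∞
      (((twistorCore g hg o).localTriv F).toOpenPartialHomeomorph.symm ∘
        fun q : ↥F.U × 𝕊² ↦ ((q.1 : M), q.2)) p
    exact (contMDiffAt_localTriv_symm g hg o F hp).comp p h1

/-- **The twistor package of `(M, o, g)` is the twistor space of `(M, o, g)`** in the sense of
`IsTwistorSpaceOf`: the tautological complex structure `J z = J_ζ(e_F(π z))` (read in the frame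
chosen at `π z`; frame-independent by `TwistorFrame.frameComplexStructure_eq`), and around each
`x₀` the frame `F` chosen at `x₀` with its trivialisation `trivDiffeo F`, under which `τ` is the
antipodal map and `ω` is the minimal-coupling form `couplingForm g ∇ e_F`.
[cite: FineKrasnovPanov2014, §4.1, Lemma 12 and Remark 13] -/
theorem isTwistorSpaceOf_twistorPackage : IsTwistorSpaceOf g o (twistorPackage g hg o) := by
  refine ⟨fun z : twistorTotal g hg o ↦ frameComplexStructure g z.proj
    ((twistorFrameAt g hg o z.proj).fr z.proj) (WithLp.ofLp (fiberCoord g hg o z : E3)),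
    fun x₀ ↦ ?_⟩
  set F := twistorFrameAt g hg o x₀ with hFdef
  refine ⟨F.U, mem_twistorFrameAt g hg o x₀, F.frame, F.contMDiffOn_frame, F.isOrthonormalFrame,
    F.isPosFrame, trivDiffeo g hg o F, fun z ↦ rfl, fun z ↦ ?_, fun z ↦ ?_, ?_⟩
  · -- `τ` is the antipodal map in the trivialisation
    refine Prod.ext (Subtype.ext rfl) ?_
    have h := congrArg Prod.snd (localTriv_twistorTau g hg o F (z.1 : twistorTotal g hg o))
    exact h
  · -- the tautological complex structure in the trivialisation
    show frameComplexStructure g (z.1 : twistorTotal g hg o).proj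
        ((twistorFrameAt g hg o (z.1 : twistorTotal g hg o).proj).fr _)
        (WithLp.ofLp (fiberCoord g hg o z.1 : E3)) =
      frameComplexStructure g (z.1 : twistorTotal g hg o).proj (F.fr _)
        (WithLp.ofLp ((triv g hg o F z.1).2 : E3))
    have hx : (z.1 : twistorTotal g hg o).proj ∈ F.U := z.2
    rw [triv_snd, coe_twistorCoordChange (x := (z.1 : twistorTotal g hg o).proj)
      (mem_twistorFrameAt g hg o _) hx, WithLp.ofLp_toLp]
    exact F.frameComplexStructure_eq (twistorFrameAt g hg o _) hx (mem_twistorFrameAt g hg o _) _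
  · -- the coupling form in the trivialisation
    show (twistorOmega g hg o).pullback (𝓡 6)
        (Subtype.val : twistorPreim g hg o F → twistorTotal g hg o) =
      (couplingForm g g.leviCivita F.frame).pullback (𝓡 6)
        (triv g hg o F ∘ (Subtype.val : twistorPreim g hg o F → twistorTotal g hg o))
    funext z
    ext v
    rw [MForm.pullback_apply, MForm.pullback_apply]
    have hval := Literature.Geometry.Manifold.OpenSubmanifold.mfderiv_subtype_val (I := 𝓡 6)
      (U := twistorPreim g hg o F) z
    have hmd := Literature.Geometry.Manifold.OpenSubmanifold.mdifferentiableAt_subtype_val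
      (I := 𝓡 6) (U := twistorPreim g hg o F) z
    rw [mfderiv_comp z (mdifferentiableAt_triv g hg o F z.2) hmd, hval,
      twistorOmega_eq g hg o F z.2, MForm.pullback_apply]
    rfl

/-- **Discharge of `exists_twistorSpace`** (Atiyah–Hitchin–Singer 1978, §4; Besse 1987, 13.44 and
13.63; Fine–Panov 2009, Prop. 2.1; Fine–Krasnov–Panov 2014, §4.1, Lemma 12 and Remark 13): every
smooth oriented Riemannian 4-manifold has a twistor space. [cite: FineKrasnovPanov2014, §4.1, Lemma 12 and Remark 13] -/
theorem exists_twistorSpace_holds : exists_twistorSpace := by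
  intro M _ _ _ _ _ o g _ hg
  exact ⟨twistorPackage g hg o, isTwistorSpaceOf_twistorPackage g hg o⟩

end Package

end Literature.Geometry.Riemannian
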